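import Mathlib
import Summits.ResolutionOfSingularities.ResolutionOfSingularities.Theorems.RadicialJungCleanModelsCleanProp44BirthOrderRestriction
import Summits.ResolutionOfSingularities.ResolutionOfSingularities.Theorems.RadicialJungCleanModelsCleanProp44FaceDegree
import Summits.ResolutionOfSingularities.ResolutionOfSingularities.Theorems.RadicialJungCleanModelsCleanProp44LeafOrderDivision
import Summits.ResolutionOfSingularities.ResolutionOfSingularities.Theorems.RadicialJungCleanModelsCleanProp44BirthCountCurve
import HarnessLib

/-!
# Route `RadicialJung`, crux `CleanModels` (stmt-ResolutionOfSingularities-15917), line `Sketch` rev 35, stub 6 `stub_cleanProp44` (X44c):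
# THE DESCENT AT A BIRTH ASSEMBLED — «`δ′ ≥ d′`» at `c′ ∈ Γ″` ⟹ `ν(c′) ≥ d′` on the base line ⟹ `Σ (d′ − 1)[κ(c′):κ] ≤ δ − 2` (recipe step (6), def-free)

Seat decomp-res-hand-2 g21 (structural hand).  COMPOSITION of ✓ `…BirthOrderRestriction` (`sub_pow_mem_sup_pow_of_presentation`: `δ ≤ ν` def-free) with the
solvable face of ✓ `…SolvableFace` / ✓ `…SuccessorCount` and the count of ✓ `…FaceDegree` (`sum_mul_natDegree_le_sub_two`).  Memo 4e §2.5 «THE DESCENT: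
`δ*(c′) ≤ r*(c′)`.  Proof: … if `J_m ⊆ Σ_e 𝓘_{L′_rep}^e 𝔪_{c′}^{⌈(μ−e)δ′⌉}` then … `J_m` restricted to the curve `K := L′_rep ∩ E` has order `≥ μδ′` at `c′`; but on `E`
`f_m = C_μ(t_m + λ)^μ` and on `K`: `v(c)·t_m = (γ − g)^p|_E`, so … `ν(c′) ≥ δ′`» and §2.6 (c) «`Σ_{c′} (ν(c′) − 1)·[κ(c′):κ(c)] ≤ deg λ′ ≤ δ − 2`: hence
`δ*(c′) ≤ δ*(c) − 1`».  Everything «on `E`» lives in a `κ[u][T]`-algebra `S` (the local ring `𝒪_{E,c′}` of the exceptional chart `𝔸²_κ`, coordinates `u`, `T = t̄_m`);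
the new leaf representative at `c′` restricted to `E` is `w = v(c)·T − G^p` (`G = (γ − g)|_E`), the curve `K = V(w) ⊂ E` has ideal `I ∋ w` with `S/I` a DVR:

* `map_mem_sup_pow_of_le_leafSum` — **«`δ′ ≥ d′`» ⟹ order `≥ μd′` along `K`**: `J ⊆ Σ_{e≤μ} (w̃^e)·𝔪^{(μ−e)d′}` upstairs (the def-free surrogate of
  ✓ `…LeafOrderDivision` for the NEW leaf `w̃`) and `r(w̃) ∈ I` (any ring map `r`, e.g. restriction to `E`) ⟹ `r(f) ∈ I + r(𝔪)^{μd′}` for every `f ∈ J`.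
* `birthOrder_ge_of_solvableFace` — **`δ′ ≤ ν_K`**: `c·(T + λ)^μ ∈ I + 𝔪^{μd′}` (`c ≠ 0`, `μ ≥ 1`), `a₀·T − G^p ∈ I` ⟹ `(−a₀)·λ − G^p ∈ I + 𝔪^{d′}`: the restricted
  unit `F = U|_E = −v(c)·λ` (✓ `restriction_unit`) is a `p`-th power to order `d′` along `K` at `c′`; `…_quotient` reads it in the DVR `S/I`.
* `exists_sub_pow_mem_span_pow_of_transfer` — **FROM `K` TO THE BASE LINE** (the local ring `D` of `K` at `c′` against `κ[u]_{(P)}`: `K → 𝔸¹_u` unramified at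
  `c′` with the same residue field, an (S) input stated as two hypotheses — every element of `D` is a polynomial modulo `𝔪_D^m`, and `ρ(h) ∈ 𝔪_D^m ⟺ P^m ∣ h`):
  `ρ(F₀) − x^p ∈ 𝔪_D^m` ⟹ `F₀·1^p + (−g)^p ∈ (P)^m` for some `g ∈ κ[u]` — the input format of ✓ `sum_mul_natDegree_le_of_add_pow_mem`.
* `descent_le_sub_two` — **THE DESCENT INEQUALITY** (recipe (5) + (6)): `F₀ = a·λ` (`a ≠ 0`), `deg λ ≤ d`, `p ∣ d`, `λ′ ≠ 0`; pairwise distinct closed points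
  `P_i` of the base line with `F₀·1^p + (−g_i)^p ∈ (P_i)^{d′_i}`, `1 ≤ d′_i` ⟹ `Σ_i (d′_i − 1)·deg P_i ≤ d − 2`; `descent_lt` — in particular every `d′_i ≤ d − 1`
  («`δ*(c′) ≤ δ*(c) − 1`» in surrogate currency, outside the corner `λ′ ≡ 0`).

Honest framing: OURS, assembly; the scheme-level inputs (the chart of `E`, `K → 𝔸¹` unramified at `c′`, the surrogate read on the tree's `controlledTransform`) are
census (S) and NOT done here; the corner `λ′ ≡ 0` over imperfect `κ(c)` is (B5′); nothing here proves X44c, any case of `CleanModels`, or resolution of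
singularities in characteristic `p`. [cite: CossartPiltant2008, Prop. 4.4 (proof, p. 11)] [cite: CossartPiltant2009, ch.1 II.5.3.2 (i)] [cite: CossartJannsenSaito2020, Lemma 7.5]
-/

noncomputable section

set_option linter.dupNamespace false -- mandated namespace of this single-conjunct summit

open Polynomial IsLocalRing

namespace Summit.ResolutionOfSingularities.ResolutionOfSingularities.Theorems.RadicialJung.CleanModels

/-! ## §1 The surrogate «`δ′ ≥ d′`» gives order `≥ μd′` along the curve `K` -/

section Surrogate

variable {R S : Type*} [CommRing R] [CommRing S] (r : R →+* S)

/-- **«`δ′ ≥ d′`» ⟹ `f` has order `≥ μd′` along `K`**: if `J ⊆ Σ_{e≤μ} (w̃^e)·𝔪^{n_e}` with `n_0 = N` (the def-free leaf-order surrogate for the new leaf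
`V(w̃)`; `n_e = (μ−e)d′`, `N = μd′`) and `r(w̃) ∈ I` (`K ⊂ V(w̃)`), then `r(f) ∈ I + (r(𝔪)S)^N` for every `f ∈ J`. [cite: CossartPiltant2008, Prop. 4.4 (proof, p. 11)] -/
theorem map_mem_sup_pow_of_le_leafSum (𝔪 : Ideal R) (I : Ideal S) {w : R} (hw : r w ∈ I) (μ : ℕ) (n : ℕ → ℕ) {J : Ideal R}
    (hJ : J ≤ ∑ e ∈ Finset.range (μ + 1), Ideal.span {w ^ e} * 𝔪 ^ n e) {f : R} (hf : f ∈ J) :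
    r f ∈ I ⊔ (𝔪.map r) ^ n 0 := by
  have h1 : J.map r ≤ I ⊔ (𝔪.map r) ^ n 0 := by
    refine (Ideal.map_mono hJ).trans ?_
    rw [map_finset_sum]
    refine Finset.sum_induction _ (fun K : Ideal S => K ≤ I ⊔ (𝔪.map r) ^ n 0) (fun a b ha hb => ?_) (by simp) fun e _ => ?_
    · rw [Ideal.add_eq_sup]; exact sup_le ha hb
    · rw [Ideal.map_mul, Ideal.map_pow, Ideal.map_span, Set.image_singleton, map_pow]
      rcases Nat.eq_zero_or_pos e with rfl | he
      · rw [pow_zero, Ideal.span_singleton_one, Ideal.top_mul]; exact le_sup_right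
      · refine (Ideal.mul_le_right).trans (le_sup_left.trans' ?_)
        rw [Ideal.span_singleton_le_iff_mem]
        exact Ideal.pow_mem_of_mem I hw e he
  exact h1 (Ideal.mem_map_of_mem r hf)

/-- The integer-weight instance `n_e = (μ−e)·d′`: `r(f) ∈ I + (r(𝔪)S)^{μd′}`. [cite: CossartPiltant2008, Prop. 4.4 (proof, p. 11)] -/
theorem map_mem_sup_pow_of_le_leafSum_weight (𝔪 : Ideal R) (I : Ideal S) {w : R} (hw : r w ∈ I) (μ d' : ℕ) {J : Ideal R}
    (hJ : J ≤ ∑ e ∈ Finset.range (μ + 1), Ideal.span {w ^ e} * 𝔪 ^ ((μ - e) * d')) {f : R} (hf : f ∈ J) :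
    r f ∈ I ⊔ (𝔪.map r) ^ (μ * d') := by
  simpa using map_mem_sup_pow_of_le_leafSum r 𝔪 I hw μ (fun e => (μ - e) * d') hJ hf

end Surrogate

/-! ## §2 The face on the curve `K`: `δ′ ≤ ν_K` -/

section Face

variable {k : Type*} [Field k] {S : Type*} [CommRing S] [Algebra (k[X])[X] S]
  (I : Ideal S) [I.IsPrime] [IsDiscreteValuationRing (S ⧸ I)] (𝔪 : Ideal S) [𝔪.IsMaximal]

/-- `⌈μd′/μ⌉ = d′`. [folklore] -/
theorem mul_add_sub_one_div {μ : ℕ} (hμ : 0 < μ) (d' : ℕ) : (μ * d' + μ - 1) / μ = d' := by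
  rw [Nat.add_sub_assoc (show 1 ≤ μ from hμ), Nat.mul_add_div hμ, Nat.div_eq_of_lt (Nat.sub_lt hμ one_pos), add_zero]

/-- **`δ′ ≤ ν_K` (memo 4e §2.5 «THE DESCENT», def-free, on the exceptional chart).**  In a `κ[u][T]`-algebra `S` (the local ring of the exceptional chart at
`c′`) with the curve ideal `I` (`S/I` a DVR) below the maximal `𝔪`: if the face `c·(T + λ)^μ` (`c ≠ 0`, `μ ≥ 1`) has order `≥ μd′` along `K`
(`∈ I + 𝔪^{μd′}`, ✓ `map_mem_sup_pow_of_le_leafSum_weight`) and the new leaf representative restricted to `E`, `a₀·T − G^p`, lies in `I`, then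
`(−a₀)·λ − G^p ∈ I + 𝔪^{d′}`: the restricted unit `−v(c)·λ` is a `p`-th power to order `d′` along `K` at `c′`. [cite: CossartPiltant2008, Prop. 4.4 (proof, p. 11)] -/
theorem birthOrder_ge_of_solvableFace (hI : I ≤ 𝔪) (p : ℕ) {c : k} (hc : c ≠ 0) (a₀ : k) (lam : k[X]) {μ d' : ℕ} (hμ : 0 < μ)
    {G : S} (hw : algebraMap (k[X])[X] S (C (C a₀) * X) - G ^ p ∈ I)
    (hf : algebraMap (k[X])[X] S (C (C c) * (X + C lam) ^ μ) ∈ I ⊔ 𝔪 ^ (μ * d')) :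
    algebraMap (k[X])[X] S (C (C (-a₀) * lam)) - G ^ p ∈ I ⊔ 𝔪 ^ d' := by
  have hC : IsUnit (algebraMap (k[X])[X] S (C (C c))) := ((isUnit_iff_ne_zero.mpr hc).map C |>.map C).map _
  have key := sub_pow_mem_sup_pow_of_presentation I 𝔪 hI p (f := algebraMap (k[X])[X] S (C (C c) * (X + C lam) ^ μ))
    (φ := algebraMap (k[X])[X] S (X + C lam)) (v := algebraMap (k[X])[X] S (C (C a₀)))
    (F := algebraMap (k[X])[X] S (C (C (-a₀) * lam))) (G := G) hC hμ hf (by rw [map_mul, map_pow, sub_self]; exact I.zero_mem)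
    (by
      have h1 : algebraMap (k[X])[X] S (C (C a₀)) * algebraMap (k[X])[X] S (X + C lam) -
          (G ^ p - algebraMap (k[X])[X] S (C (C (-a₀) * lam))) = algebraMap (k[X])[X] S (C (C a₀) * X) - G ^ p := by
        simp only [map_add, map_neg, map_mul]
        ring
      rw [h1]; exact hw)
  rwa [mul_add_sub_one_div hμ] at key

/-- The same read in the DVR `S/I` (✓ `exists_sub_pow_mem_sup_pow_iff`): some `F̄ − c̄^p ∈ 𝔪̄^{d′}` — «`ν_K(c′) ≥ d′`». [cite: CossartPiltant2008, Prop. 4.4 (proof, p. 11)] -/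
theorem birthOrder_ge_of_solvableFace_quotient (hI : I ≤ 𝔪) (p : ℕ) {c : k} (hc : c ≠ 0) (a₀ : k) (lam : k[X]) {μ d' : ℕ}
    (hμ : 0 < μ) {G : S} (hw : algebraMap (k[X])[X] S (C (C a₀) * X) - G ^ p ∈ I)
    (hf : algebraMap (k[X])[X] S (C (C c) * (X + C lam) ^ μ) ∈ I ⊔ 𝔪 ^ (μ * d')) :
    ∃ c' : S ⧸ I, Ideal.Quotient.mk I (algebraMap (k[X])[X] S (C (C (-a₀) * lam))) - c' ^ p ∈ (𝔪.map (Ideal.Quotient.mk I)) ^ d' :=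
  (exists_sub_pow_mem_sup_pow_iff I 𝔪 p d' _).mp ⟨G, birthOrder_ge_of_solvableFace I 𝔪 hI p hc a₀ lam hμ hw hf⟩

end Face

/-! ## §3 From the curve `K` to the base line `𝔸¹_κ` -/

section Transfer

variable {k : Type*} [Field k] {D : Type*} [CommRing D] (ρ : k[X] →+* D) (𝔫 : Ideal D) (p : ℕ) [hp : Fact p.Prime]
  [CharP k p] [CharP D p]

/-- **Transfer of a birth order along an unramified pointed map with dense image** (`D` the local ring of `K` at `c′`, `ρ : κ[u] → D` the projection to the base
line, `𝔫` the maximal ideal; (S) supplies: every `x ∈ D` is `ρ(g)` modulo `𝔫^m`, and `ρ(h) ∈ 𝔫^m → P^m ∣ h`): `ρ(F₀) − x^p ∈ 𝔫^m` ⟹ `F₀·1^p + (−g)^p ∈ (P)^m` for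
some polynomial `g` — the input format of ✓ `sum_mul_natDegree_le_of_add_pow_mem`. [folklore] -/
theorem exists_sub_pow_mem_span_pow_of_transfer {m : ℕ} (hdense : ∀ x : D, ∃ g : k[X], x - ρ g ∈ 𝔫 ^ m) {P : k[X]}
    (hord : ∀ h : k[X], ρ h ∈ 𝔫 ^ m → h ∈ Ideal.span {P} ^ m) {F₀ : k[X]} {x : D} (hx : ρ F₀ - x ^ p ∈ 𝔫 ^ m) :
    ∃ g : k[X], F₀ * 1 ^ p + (-g) ^ p ∈ Ideal.span {P} ^ m := by
  obtain ⟨g, hg⟩ := hdense x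
  refine ⟨g, ?_⟩
  rw [← sub_pow_eq_mul_one_pow_add_neg_pow p]
  apply hord
  -- `x^p − ρ(g)^p = (x − ρ g)^p ∈ 𝔫^m`
  have hp1 : p = (p - 1) + 1 := (Nat.sub_add_cancel hp.out.one_le).symm
  have h1 : x ^ p - ρ g ^ p ∈ 𝔫 ^ m := by
    rw [← sub_pow_char x (ρ g), hp1, pow_succ']
    exact Ideal.mul_mem_right _ _ hg
  have h2 : ρ (F₀ - g ^ p) = (ρ F₀ - x ^ p) + (x ^ p - ρ g ^ p) := by rw [map_sub, map_pow]; ring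
  rw [h2]
  exact Ideal.add_mem _ hx h1

end Transfer

/-! ## §4 Assembled at one birth: «`δ′ ≥ d′`» on `E` ⟹ `ν ≥ d′` on the base line -/

section Assembled

variable {k : Type*} [Field k] {S : Type*} [CommRing S] [Algebra (k[X])[X] S]
  (I : Ideal S) [I.IsPrime] [IsDiscreteValuationRing (S ⧸ I)] (𝔪 : Ideal S) [𝔪.IsMaximal]

/-- **THE DESCENT AT ONE BIRTH** (memo 4e §2.5–2.6 «`δ*(c′) ≤ ν(c′)`», def-free): on the exceptional chart at `c′` (`S`, curve ideal `I` of `K`, `S/I` a DVR of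
characteristic `p`, maximal `𝔪 ⊇ I`), the face `c(T + λ)^μ` of order `≥ μd′` along `K` and the new leaf `a₀T − G^p ∈ I` give — through the projection `ρ` of `K` to
the base line `κ[u]` (dense modulo `𝔪̄^{d′}`, order-detecting at the closed point `P`) — a polynomial `g` with `(−a₀)λ·1^p + (−g)^p ∈ (P)^{d′}`: the restricted unit
`F₀ = −v(c)·λ` has birth order `ν(P) ≥ d′` ON THE BASE LINE, in the format of ✓ `sum_mul_natDegree_le_of_add_pow_mem` / `descent_le_sub_two`.
[cite: CossartPiltant2008, Prop. 4.4 (proof, p. 11)] [cite: CossartPiltant2009, ch.1 II.5.3.2 (i)] -/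
theorem descent_at_birth (hI : I ≤ 𝔪) (p : ℕ) [Fact p.Prime] [CharP k p] [CharP (S ⧸ I) p] {c : k} (hc : c ≠ 0) (a₀ : k)
    (lam : k[X]) {μ d' : ℕ} (hμ : 0 < μ) {G : S} (hw : algebraMap (k[X])[X] S (C (C a₀) * X) - G ^ p ∈ I)
    (hf : algebraMap (k[X])[X] S (C (C c) * (X + C lam) ^ μ) ∈ I ⊔ 𝔪 ^ (μ * d'))
    (hdense : ∀ x : S ⧸ I, ∃ g : k[X],
      x - ((Ideal.Quotient.mk I).comp ((algebraMap (k[X])[X] S).comp C)) g ∈ (𝔪.map (Ideal.Quotient.mk I)) ^ d')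
    {P : k[X]} (hord : ∀ h : k[X], ((Ideal.Quotient.mk I).comp ((algebraMap (k[X])[X] S).comp C)) h ∈
      (𝔪.map (Ideal.Quotient.mk I)) ^ d' → h ∈ Ideal.span {P} ^ d') :
    ∃ g : k[X], C (-a₀) * lam * 1 ^ p + (-g) ^ p ∈ Ideal.span {P} ^ d' := by
  obtain ⟨c', hc'⟩ := birthOrder_ge_of_solvableFace_quotient I 𝔪 hI p hc a₀ lam hμ hw hf
  exact exists_sub_pow_mem_span_pow_of_transfer _ _ p hdense hord (x := c') (by simpa using hc')

end Assembled

/-! ## §5 The descent inequality on the successor line -/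

section Descent

variable {k : Type*} [Field k] (p : ℕ) [Fact p.Prime] [CharP k p]

/-- Under `deg λ ≤ d`, `(d : κ) = 0` and `λ′ ≠ 0` one has `2 ≤ d`. [folklore] -/
theorem two_le_of_derivative_ne_zero {lam : k[X]} {d : ℕ} (hdeg : lam.natDegree ≤ d) (hd : (d : k) = 0)
    (hlam : derivative lam ≠ 0) : 2 ≤ d := by
  by_contra h
  have hd' : d = 0 ∨ d = 1 := by omega
  rcases hd' with rfl | rfl
  · apply hlam
    rw [eq_C_of_natDegree_eq_zero (Nat.eq_zero_of_le_zero hdeg), derivative_C]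
  · simp at hd

/-- **THE DESCENT INEQUALITY** (memo 4e §2.5 «`Σ_{births c′} (r*(c′) − 1)·[κ(c′):κ(c)] ≤ δ − 2`», §2.6 (c), in surrogate currency): `F₀ = a·λ` (`a ≠ 0`),
`deg λ ≤ d`, `p ∣ d`, `λ′ ≠ 0`; pairwise distinct closed points `P_i` of the base line with `F₀·1^p + (−g_i)^p ∈ (P_i)^{d′_i}` (✓ `descent_at_birth`: the new
weighted leaf orders `d′_i ≥ 1` at the births on `Γ″`) ⟹ `Σ_i (d′_i − 1)·deg P_i ≤ d − 2`. [cite: CossartPiltant2008, Prop. 4.4 (proof, p. 11)]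
[cite: CossartPiltant2009, ch.1 II.5.3.2 (i)] -/
theorem descent_le_sub_two {a : k} (ha : a ≠ 0) {lam : k[X]} {d : ℕ} (hdeg : lam.natDegree ≤ d) (hd : (d : k) = 0)
    (hlam : derivative lam ≠ 0) {ι : Type*} (s : Finset ι) (P g : ι → k[X]) (d' : ι → ℕ)
    (hP : ∀ i ∈ s, Prime (P i)) (hne : ∀ i ∈ s, ∀ j ∈ s, i ≠ j → ¬ P i ∣ P j) (hd' : ∀ i ∈ s, 1 ≤ d' i)
    (h : ∀ i ∈ s, C a * lam * 1 ^ p + (-g i) ^ p ∈ Ideal.span {P i} ^ d' i) :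
    ∑ i ∈ s, (d' i - 1) * (P i).natDegree ≤ d - 2 := by
  refine sum_mul_natDegree_le_sub_two p ha hdeg hd hlam s P (fun _ => 1) (fun i => -g i) (fun i => d' i - 1) hP hne
    (fun i hi h1 => (hP i hi).not_unit (isUnit_of_dvd_one h1)) fun i hi => ?_
  rw [Nat.sub_add_cancel (hd' i hi)]
  exact h i hi

/-- **Hence `δ*(c′) ≤ δ*(c) − 1`** (surrogate currency): each birth on `Γ″` has new weighted leaf order `d′_i ≤ d − 1`. [cite: CossartPiltant2008, Prop. 4.4 (proof, p. 11)] -/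
theorem descent_lt {a : k} (ha : a ≠ 0) {lam : k[X]} {d : ℕ} (hdeg : lam.natDegree ≤ d) (hd : (d : k) = 0)
    (hlam : derivative lam ≠ 0) {ι : Type*} (s : Finset ι) (P g : ι → k[X]) (d' : ι → ℕ)
    (hP : ∀ i ∈ s, Prime (P i)) (hne : ∀ i ∈ s, ∀ j ∈ s, i ≠ j → ¬ P i ∣ P j) (hd' : ∀ i ∈ s, 1 ≤ d' i)
    (h : ∀ i ∈ s, C a * lam * 1 ^ p + (-g i) ^ p ∈ Ideal.span {P i} ^ d' i) :
    ∀ i ∈ s, d' i ≤ d - 1 := by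
  intro i hi
  have key := descent_le_sub_two p ha hdeg hd hlam s P g d' hP hne hd' h
  have hd2 := two_le_of_derivative_ne_zero (k := k) hdeg hd hlam
  have hdeg1 : 1 ≤ (P i).natDegree := by
    by_contra h0
    have h0' : (P i).natDegree = 0 := by omega
    apply (hP i hi).not_unit
    rw [eq_C_of_natDegree_eq_zero h0']
    refine (isUnit_iff_ne_zero.mpr fun hc => (hP i hi).ne_zero ?_).map C
    rw [eq_C_of_natDegree_eq_zero h0', hc, C_0]
  have h1 : (d' i - 1) * (P i).natDegree ≤ d - 2 :=
    (Finset.single_le_sum (f := fun i => (d' i - 1) * (P i).natDegree) (fun _ _ => Nat.zero_le _) hi).trans key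
  have h2 : d' i - 1 ≤ d - 2 := le_trans (Nat.le_mul_of_pos_right _ hdeg1) h1
  omega

end Descent

end Summit.ResolutionOfSingularities.ResolutionOfSingularities.Theorems.RadicialJung.CleanModels

end
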